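import Mathlib
import HarnessLib
import Summits.Langlands.Langlands.Theses.ParityBlindBianchi
import Summits.Langlands.Langlands.Theses.RuelleTorsionArtinWeight
import Summits.Langlands.Langlands.Theorems.ParityBlindBianchiArtinWeightRealisationLevelCuspFormsDischarged
import Literature.NumberTheory.Automorphic.PiOfArtinRepAtSigmaUnramifiedPlaces
import Literature.NumberTheory.Automorphic.StrongArtinGL2
import Literature.NumberTheory.GaloisRepresentations.FramedRepTwist

/-!
# SKELETON — crux stmt-Langlands-15111 `ParityBlindBianchi.ArtinWeightRealisationLevel` (R′),
# line `SketchIdeator5-r2` = idea `hermitian-wall-patching` (round 2, ideator 5)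

Lead prover-line-stmt-Langlands-15111-a2-0, 2026-08-17.  The ideator's `SketchIdeator5_r2.lean`
(rc 0, 0 sorries) has NO by-name composition to R′ (only `even_of_stubs` over abstract `Prop`s to R″),
so this file builds the eligible skeleton from the card's §Assembly sketch
(`stub_residualWall → stub_amplitude → stub_torsionLGC → stub_patch → stub_exit → R on the polarizable
sector`, plus the card's conceded residual `stub_genuineSector`).  The tree has no vocabulary for
Shimura varieties of `U(2,2)`, their coherent cohomology or Hermitian modular forms, so the card's
K2 + K1′ + K3 + K1 (residual wall occurrence → amplitude → torsion local–global compatibility →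
Calegari–Geraghty patching at the Siegel–Eisenstein ideal) are necessarily ONE opaque stub
`stub_hermitianWallHost` whose statable output is the sibling card's `GL4HostPattern` (a1's
definition, verbatim, so that `stub_gl4HostExit` keeps a1's registered signature).  The polarizable
sector is typed as c15's descent-up-to-twist sector `σ = (ρ|_K) ⊗ ψ` (for projectively icosahedral σ
the two agree: `σᶜ ≃ σ ⊗ χ` iff the projectivisation descends to `Γ_ℚ`, Tate).  Composition through the
accepted `artinWeightRealisationLevel_of_artinWeightRealisation_insoluble_of_gelbart` (p115022):
LT ⊕ (line on the descending insoluble sector) ⊕ (residual: the NON-descending insoluble sector) ⇒ R′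
BY NAME.  Sorries: exactly the five `stub_*`.
-/

noncomputable section

open scoped BigOperators Topology Classical Matrix Polynomial NumberField
open Filter Set Function
open Literature.NumberTheory.Automorphic Literature.NumberTheory.GaloisRepresentations
  IsDedekindDomain

set_option linter.dupNamespace false

namespace Summit.Langlands.Langlands.Theorems.ArtinWeightRealisationLevel

/-- **Host pattern** over a number field `L` (verbatim the sibling line's `GL4HostPattern`, a1): an
automorphic representation `Θ` of `GL₄(𝔸_L)` whose Satake multiset at a.e. `v` is
`A·q_v^{-1/2} ⊎ B·q_v^{1/2}` with `B` unitary and `A` carrying the arithmetic-Frobenius polynomial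
of `σ` — the weak base change to `GL₄/K` of the CAP form `(σψ′) ⊠ S₂` the card's patching outputs.
[folklore] -/
def GL4HostPattern (L : Type) [Field L] [NumberField L] (p : ℕ) [Fact p.Prime]
    (ι : PadicAlgCl p ≃+* ℂ) (σ : FramedGaloisRep L (PadicAlgCl p) 2) : Prop :=
  ∃ (hcpt4 : isCompact_glFiniteIntegralLevel 4 L)
    (Θ : AutomorphicRepData (AutomorphyDatum.gl 4 L hcpt4)),
    ∀ᶠ v : HeightOneSpectrum (𝓞 L) in cofinite, ∃ A B : Multiset ℂ,
      Θ.HasSatakeParamAt v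
          (A.map (fun a ↦ a * (((Real.sqrt (v.residueCard : ℝ) : ℝ) : ℂ))⁻¹) +
            B.map (fun b ↦ b * ((Real.sqrt (v.residueCard : ℝ) : ℝ) : ℂ))) ∧
        (∀ b ∈ B, ‖b‖ = 1) ∧
        σ.IsUnramifiedAt v ∧ σ.HasFrobCharpolyAt v (arithFrobPolyOfSatake ι v.residueCard 1 A)

/-! ## The five registered stubs -/

/-- **stub_hermitianWallHost** (card K2 + K1′ + K3 + K1 in one statable step — the line's Transfer
C⁺ `HermitianWallLifting` with the residual wall occurrence folded in): for `K` imaginary quadratic and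
`σ` finite-image, irreducible, projectively insoluble and DESCENDING UP TO TWIST (= polarizable), the
`p`-adic automorphy package of R (`S`-form: Hecke point of the `p`-power tower + Hansen association off
`S`) yields the `GL₄/K` host pattern (classical holomorphic weight-2 Hermitian CAP cusp form with
eigensystem `ℰ(σψ)`, weakly base-changed to `GL₄/K`).  NOT IN PRINT (card §What-it-needs K1–K3,
each "why it might fail"). [folklore] -/
theorem stub_hermitianWallHost : ∀ (K : Type) [Field K] [NumberField K], NumberField.IsTotallyComplex K → Module.finrank ℚ K = 2 → ∀ (p : ℕ) [Fact p.Prime] (ι : PadicAlgCl p ≃+* ℂ) (σ : Literature.NumberTheory.GaloisRepresentations.FramedGaloisRep K (PadicAlgCl p) 2), Finite σ.toMonoidHom.range → σ.toGaloisRep.IsIrreducible → ¬ IsSolvable (Literature.NumberTheory.GaloisRepresentations.projectiveImage σ.toMonoidHom) → (∃ (ρ : Literature.NumberTheory.GaloisRepresentations.FramedGaloisRep ℚ (PadicAlgCl p) 2) (ψ : Field.absoluteGaloisGroup K →ₜ* (PadicAlgCl p)ˣ), Finite ρ.toMonoidHom.range ∧ Finite ψ.toMonoidHom.range ∧ Literature.NumberTheory.GaloisRepresentations.FramedRep.twist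 (ρ.restrictField K) ψ = σ) → (∃ (S : Finset (IsDedekindDomain.HeightOneSpectrum (NumberField.RingOfIntegers K))) (U : Subgroup (GL (Fin 2) (IsDedekindDomain.FiniteAdeleRing (NumberField.RingOfIntegers K) K))) (ϖ : ∀ v : IsDedekindDomain.HeightOneSpectrum (NumberField.RingOfIntegers K), (v.adicCompletion K)ˣ) (a : {v : IsDedekindDomain.HeightOneSpectrum (NumberField.RingOfIntegers K) // v ∉ S} → ℕ → (Valued.v (R := PadicAlgCl p)).valuationSubring), (∀ v : IsDedekindDomain.HeightOneSpectrum (NumberField.RingOfIntegers K), ((p : ℕ) : NumberField.RingOfIntegers K) ∈ v.asIdeal → v ∈ S) ∧ IsOpen (U : Set (GL (Fin 2) (IsDedekindDomain.FiniteAdeleRing (NumberField.RingOfIntegers K) K))) ∧ U ≤ Literature.NumberTheory.Automorphic.glFiniteIntegralLevel 2 K ∧ (∀ g ∈ Literature.NumberTheory.Automorphic.glFiniteIntegralLevel 2 K, (∀ v ∈ S, ∀ i j : Fin 2, ((g : Matrix (Fin 2) (Fin 2) (IsDedekindDomain.FiniteAdeleRing (NumberField.RingOfIntegers K) K)) i j)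 v = (1 : Matrix (Fin 2) (Fin 2) (v.adicCompletion K)) i j) → g ∈ U) ∧ (∀ v : IsDedekindDomain.HeightOneSpectrum (NumberField.RingOfIntegers K), Valued.v ((ϖ v : (v.adicCompletion K)ˣ) : v.adicCompletion K) = WithZero.exp (-1 : ℤ)) ∧ Literature.NumberTheory.Automorphic.IsHeckePoint (Matrix.GeneralLinearGroup.map (n := Fin 2) (algebraMap K (IsDedekindDomain.FiniteAdeleRing (NumberField.RingOfIntegers K) K))) (Literature.NumberTheory.Automorphic.LevelTower.ofSeq U (fun r : ℕ => (Literature.NumberTheory.Automorphic.principalCongruenceLevel 2 K (Ideal.span {((p : ℕ) : NumberField.RingOfIntegers K)} ^ r)).map (Literature.NumberTheory.Automorphic.GLn.sndHom 2 K))) ((p : ℕ) : (Valued.v (R := PadicAlgCl p)).valuationSubring) (fun j : {v : IsDedekindDomain.HeightOneSpectrum (NumberField.RingOfIntegers K) // v ∉ S} × Fin 2 => Literature.NumberTheory.Automorphic.GLn.sndHom 2 K (Literature.NumberTheory.Automorphic.heckeDiagAt 2 K j.1.1 (ϖ j.1.1) (j.2.val + 1))) (fun j => a j.1 (j.2.val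 + 1)) ∧ ∀ (v : IsDedekindDomain.HeightOneSpectrum (NumberField.RingOfIntegers K)) (hv : v ∉ S), σ.IsHeckeAssociatedAt v (fun i : ℕ => if i = 0 then (1 : PadicAlgCl p) else ((a ⟨v, hv⟩ i : (Valued.v (R := PadicAlgCl p)).valuationSubring) : PadicAlgCl p))) → GL4HostPattern K p ι σ := by
  sorry

/-- **stub_gl4HostExit** (card P1, verbatim the sibling line's registered stub): exit by cuspidal
support — Jacquet–Shalika sorts the Satake multiset by absolute value, the tempered `GL₂` constituent
is cuspidal and matches `σ` a.e. (Langlands 1979 Prop. 2 + Jacquet–Shalika 1981 + Chebotarev /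
Brauer–Nesbitt).  Theorem-level, every ingredient an unvendored XL fact. [cite: Langlands1979Notion, Prop. 2] -/
theorem stub_gl4HostExit :
    ∀ (L : Type) [Field L] [NumberField L] (p : ℕ) [Fact p.Prime] (ι : PadicAlgCl p ≃+* ℂ) (σ : FramedGaloisRep L (PadicAlgCl p) 2), Finite σ.toMonoidHom.range → σ.toGaloisRep.IsIrreducible → GL4HostPattern L p ι σ → ∃ (hcpt : isCompact_glFiniteIntegralLevel 2 L) (π : CuspidalAutomorphicRepData 2 L hcpt), ∀ᶠ w : HeightOneSpectrum (𝓞 L) in cofinite, Summit.Langlands.SatakeFrobCompatibleAt ι π.1 σ w := by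
  sorry

/-- **stub_nonDescendingSector** (the card's conceded residual `stub_genuineSector`): the shared crux R
(a.e. conclusion, `S`-form hypothesis package) on the σ with INSOLUBLE projective image that are NOT
`(ρ|_K) ⊗ ψ` for any finite-image `ρ : Γ_ℚ → GL₂(ℚ̄_p)`, `ψ` — the non-polarizable icosahedral sector
the card "does NOT attack".  By c15's `artinWeightRealisationLevel_of_nondescending_sector` this is
exactly the open residue of R′ ≡ R modulo LT + KW + Booker + TARGET + AC + JL. [folklore] -/
theorem stub_nonDescendingSector : ∀ (K : Type) [Field K] [NumberField K], NumberField.IsTotallyComplex K → Module.finrank ℚ K = 2 → ∀ (p : ℕ) [Fact p.Prime] (ι : PadicAlgCl p ≃+* ℂ) (σ : Literature.NumberTheory.GaloisRepresentations.FramedGaloisRep K (PadicAlgCl p) 2), Finite σ.toMonoidHom.range → σ.toGaloisRep.IsIrreducible → ¬ IsSolvable (Literature.NumberTheory.GaloisRepresentations.projectiveImage σ.toMonoidHom) → ¬ (∃ (ρ : Literature.NumberTheory.GaloisRepresentations.FramedGaloisRep ℚ (PadicAlgCl p) 2) (ψ : Field.absoluteGaloisGroup K →ₜ* (PadicAlgCl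 p)ˣ), Finite ρ.toMonoidHom.range ∧ Finite ψ.toMonoidHom.range ∧ Literature.NumberTheory.GaloisRepresentations.FramedRep.twist (ρ.restrictField K) ψ = σ) → (∃ (S : Finset (IsDedekindDomain.HeightOneSpectrum (NumberField.RingOfIntegers K))) (U : Subgroup (GL (Fin 2) (IsDedekindDomain.FiniteAdeleRing (NumberField.RingOfIntegers K) K))) (ϖ : ∀ v : IsDedekindDomain.HeightOneSpectrum (NumberField.RingOfIntegers K), (v.adicCompletion K)ˣ) (a : {v : IsDedekindDomain.HeightOneSpectrum (NumberField.RingOfIntegers K) // v ∉ S} → ℕ → (Valued.v (R := PadicAlgCl p)).valuationSubring), (∀ v : IsDedekindDomain.HeightOneSpectrum (NumberField.RingOfIntegers K), ((p : ℕ) : NumberField.RingOfIntegers K) ∈ v.asIdeal → v ∈ S) ∧ IsOpen (U : Set (GL (Fin 2) (IsDedekindDomain.FiniteAdeleRing (NumberField.RingOfIntegers K) K))) ∧ U ≤ Literature.NumberTheory.Automorphic.glFiniteIntegralLevel 2 K ∧ (∀ g ∈ Literature.NumberTheory.Automorphic.glFiniteIntegralLevel 2 K, (∀ v ∈ S, ∀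 i j : Fin 2, ((g : Matrix (Fin 2) (Fin 2) (IsDedekindDomain.FiniteAdeleRing (NumberField.RingOfIntegers K) K)) i j) v = (1 : Matrix (Fin 2) (Fin 2) (v.adicCompletion K)) i j) → g ∈ U) ∧ (∀ v : IsDedekindDomain.HeightOneSpectrum (NumberField.RingOfIntegers K), Valued.v ((ϖ v : (v.adicCompletion K)ˣ) : v.adicCompletion K) = WithZero.exp (-1 : ℤ)) ∧ Literature.NumberTheory.Automorphic.IsHeckePoint (Matrix.GeneralLinearGroup.map (n := Fin 2) (algebraMap K (IsDedekindDomain.FiniteAdeleRing (NumberField.RingOfIntegers K) K))) (Literature.NumberTheory.Automorphic.LevelTower.ofSeq U (fun r : ℕ => (Literature.NumberTheory.Automorphic.principalCongruenceLevel 2 K (Ideal.span {((p : ℕ) : NumberField.RingOfIntegers K)} ^ r)).map (Literature.NumberTheory.Automorphic.GLn.sndHom 2 K))) ((p : ℕ) : (Valued.v (R := PadicAlgCl p)).valuationSubring) (fun j : {v : IsDedekindDomain.HeightOneSpectrum (NumberField.RingOfIntegers K) // v ∉ S} × Fin 2 => Literature.NumberTheory.Automorphic.GLn.sndHom 2 K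 (Literature.NumberTheory.Automorphic.heckeDiagAt 2 K j.1.1 (ϖ j.1.1) (j.2.val + 1))) (fun j => a j.1 (j.2.val + 1)) ∧ ∀ (v : IsDedekindDomain.HeightOneSpectrum (NumberField.RingOfIntegers K)) (hv : v ∉ S), σ.IsHeckeAssociatedAt v (fun i : ℕ => if i = 0 then (1 : PadicAlgCl p) else ((a ⟨v, hv⟩ i : (Valued.v (R := PadicAlgCl p)).valuationSubring) : PadicAlgCl p))) → ∃ (hcpt : Literature.NumberTheory.Automorphic.isCompact_glFiniteIntegralLevel 2 K) (π : Literature.NumberTheory.Automorphic.CuspidalAutomorphicRepData 2 K hcpt), ∀ᶠ w : IsDedekindDomain.HeightOneSpectrum (NumberField.RingOfIntegers K) in Filter.cofinite, Summit.Langlands.SatakeFrobCompatibleAt ι π.1 σ w := by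
  sorry

/-- **stub_strongArtinOfIsSolvable** = the NAMED FACT `strongArtin_of_isSolvable` (Langlands–Tunnell in
automorphic form, Gelbart 1997 Thm. 2.1), consumed by the closing kit for the solvable sector.
[cite: Gelbart1997, Thm. 2.1] -/
theorem stub_strongArtinOfIsSolvable : strongArtin_of_isSolvable := by
  sorry

/-- **stub_gelbartShadow** = the NAMED FACT `frobSatakeCompatibleAt_of_isPiOfArtinRep_of_isUnramifiedAt`
(Gelbart 1997 Prop. 4.1, σ-unramified shadow ⇐ `JacquetLanglands1970_twistedHeckeTheoryGL2`), consumed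
by the closing kit for "a.e. ⇒ every good place". [cite: Gelbart1997, Prop. 4.1] -/
theorem stub_gelbartShadow : frobSatakeCompatibleAt_of_isPiOfArtinRep_of_isUnramifiedAt := by
  sorry

/-! ## Composition -/

/-- **The crux BY NAME** from the five stubs, through the accepted
`artinWeightRealisationLevel_of_artinWeightRealisation_insoluble_of_gelbart` (p115022): the solvable
sector is Langlands–Tunnell, the descending insoluble sector is the line (host ∘ exit), the
non-descending insoluble sector is the residual stub. [folklore] -/
theorem ArtinWeightRealisationLevel_of :
    Summit.Langlands.Langlands.Theses.ParityBlindBianchi.ArtinWeightRealisationLevel := by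
  refine artinWeightRealisationLevel_of_artinWeightRealisation_insoluble_of_gelbart
    stub_strongArtinOfIsSolvable stub_gelbartShadow ?_
  intro K _ _ hK h2 p _ ι σ hfin hirr hins hyp
  by_cases hsec : (∃ (ρ : Literature.NumberTheory.GaloisRepresentations.FramedGaloisRep ℚ (PadicAlgCl p) 2) (ψ : Field.absoluteGaloisGroup K →ₜ* (PadicAlgCl p)ˣ), Finite ρ.toMonoidHom.range ∧ Finite ψ.toMonoidHom.range ∧ Literature.NumberTheory.GaloisRepresentations.FramedRep.twist (ρ.restrictField K) ψ = σ)
  · exact stub_gl4HostExit K p ι σ hfin hirr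
      (stub_hermitianWallHost K hK h2 p ι σ hfin hirr hins hsec hyp)
  · exact stub_nonDescendingSector K hK h2 p ι σ hfin hirr hins hsec hyp

end Summit.Langlands.Langlands.Theorems.ArtinWeightRealisationLevel

end
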